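import Summits.ResolutionOfSingularities.ResolutionOfSingularities.Theorems.SubfieldContactFrames
import Literature.AlgebraicGeometry.Resolution.PIndependence
import Literature.AlgebraicGeometry.Resolution.DiffOpPowerSeriesZeroSection
import Literature.AlgebraicGeometry.Resolution.DiffIdealStalk
import Literature.AlgebraicGeometry.Resolution.DiffIdealSupportOrder
import Literature.AlgebraicGeometry.Resolution.OrderSemicontinuity
import Literature.AlgebraicGeometry.Resolution.PrincipalizationToResolution
import Literature.AlgebraicGeometry.Resolution.ExcellentRingsFieldProofs
import Literature.AlgebraicGeometry.Resolution.QuasiExcellentSchemes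
import Literature.AlgebraicGeometry.Resolution.HypersurfaceTransform
import Literature.AlgebraicGeometry.Resolution.IdealSheafLemmas
import Literature.AlgebraicGeometry.Resolution.AlterationsProofs
import HarnessLib

/-!
# SubfieldContactSpreads — decomp-res node «SubfieldContact» (lens-6 g19, critic rows 147/147b/147c/147d), tree
file 5/6 of the node

Content VERBATIM from the decomp-res lens-6 g19 node file `HOME/decomp-res-lens-6/g19/SubfieldContact.lean` (rev 2
pin cc5614fe…, 933 l (append-only superset of rev 1 ba733ec4: +§11);
= `parts/SubfieldContact-g19-rev2-cc5614fe.lean`; HOME = run/shared/lean/pub/decomp-res).  Critic: CRITIC-LEDGER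
rows 147 (node 90f156f3 CLEARED) and 147b
(rev 1 = MAP +1, window (M2) consumed; «rev 1 ba733ec4 SUPERSEDES 90f156f3 as the source of
Theorems/SubfieldContactClasses», order 2026-08-30T22:19:25Z).
Landed by decomp-res writer g8 in the lens's namespace `…Theorems.SubfieldContactClasses`, split CONE-AWARE for
the 400-line limit: `SubfieldContactClasses`
(§1–§6), `SubfieldContactFrames` (§7), `SubfieldContactAbs` (§8–§9), `SubfieldContactPowAdjoin` (§10) are
OUTSIDE the Theses cone (the lens's cone import
`MaxContactCutTauLadder` is used only by the «…_of_items» / «…_of_pieces» up-links from the MaxContactCut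
items, which live in the in-cone wiring file
`MaxContactCutSubfieldContact`).  All `--supports stmt-ResolutionOfSingularities-29273` (`RungOne` = `E 2 → E 1`).
 Route bookkeeping (critic rows 147/147b):
ONE located-residual aside `E1NoSubDvd` (home `SubfieldContactClasses`) on 29273; the NEW LEMMA `SubfieldContactAbs`
(skeleton §9 BY NAME: stubs
`StalkSubfieldContactAbs` / `ContactSpreads` / `SubfieldContactGlue`, `PowAdjoinBase` PROVED by
`powAdjoinBase_holds`) is booked as the prover target (kind aside
under the NAMED-RUNG RULE — outside the cone of `closes`); `SubfieldContact` is its kernel corollary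
(`subfieldContact_of_abs`) and is NOT served separately.
rev 2 (cc5614fe, critic row 147c, order 2026-08-30T22:30:05Z: «supersedes rev 1 as source; land §10–§11») adds
§11 PIECE C PROVED (`subfieldContactGlue_holds`) to file 4/6;
PIECE L2 `ContactSpreads` PROVED (lens-6 g19 `parts/PieceL2-g19-52cf1017.lean`, critic row 147d, order 22:50:05Z
(2): «fold contactSpreads_holds + helpers into the pieces landing in the node
namespace, drop the scratch copies of the definitions») is file 5/6 `SubfieldContactSpreads`; so the support item
`SubfieldContactAbs` is left with the SINGLE stub `StalkSubfieldContactAbs`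
(composition: `subfieldContactAbs_of_pieces'' h contactSpreads_holds`).

PIECE L2 PROVED (lens-6 g19 `parts/PieceL2-g19-52cf1017.lean`, 248 l, critic row 147d: defs verbatim = rev 2, rc 0,
standard axioms), folded into the node
namespace per the critic's rider: `ContactSpreadsQC`, `exists_section_of_isStalkContactPt`,
`germ_mem_maximalIdeal_of_idealOrder_eq`,
`exists_opens_forall_germ_not_mem_sq`, `germ_stalkIso_topIso_inv`, `germ_topIso_inv_not_mem_sq_iff`,
`exists_opens_forall_germ_not_mem_sq'`,
**`contactSpreads_holds : ContactSpreads`**, `contactSpreadsQC_holds`.  The scratch copies of `IsStalkContactPt` /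
`ContactSpreads` are DROPPED (the
landed `SubfieldContactFrames` §7 definitions are used — dedup.fqn); scratch namespace
`…SubfieldContactClassesScratchL2` ↦ the node namespace; opens and
Literature imports as in the piece file.  0 sorry.  Imports `SubfieldContactFrames`.  Cone-free.

[WRITER NOTE (decomp-res writer g8): section split only; namespace, opens, section variables and every declaration
exactly as in the lens (global
`set_option` dropped; the cone import replaced in the cone-free files by the cone-free `WeakOrderReduction`, already
under `PurityValveClasses`).]

(Sources: EGAIV4 §16.8; Matsumura1987 §26, Thm 30.6; Giraud1975; EncinasVillamayor2000GoodPoints §4;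
BierstoneGrigorievMilmanWlodarczyk2011 §3; CossartJannsenSaito2020 Thm 1.4; CossartPiltant2008I Thm 2.1;
Cossart2011WeakMaximalContact; CossartPiltant2019; Kollar2007 §3.9.)
-/

noncomputable section

namespace Summit.ResolutionOfSingularities.ResolutionOfSingularities.Theorems.SubfieldContactClasses

open CategoryTheory AlgebraicGeometry TopologicalSpace
open Literature.AlgebraicGeometry.Resolution
open Summit.ResolutionOfSingularities.ResolutionOfSingularities.Theorems
open WeakOrderReduction ForcedTowerClasses PurityValveClasses

open IsLocalRing

/-- PIECE L2 with the extra (harmless) quasi-compactness hypothesis. -/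
def ContactSpreadsQC : Prop :=
  ∀ (F : Type) [Field F] (Y : Scheme.{0}) (f : Y ⟶ Spec (.of F)), LocallyOfFiniteType f → QuasiCompact f →
    Scheme.IsRegular Y →
    ∀ (I : Y.IdealSheafData) (n : ℕ), 1 ≤ n → (∀ y : Y, idealOrder I y ≤ ((n : ℕ) : ℕ∞)) →
      ∀ y : Y, idealOrder I y = ((n : ℕ) : ℕ∞) → IsStalkContactPt f I n y →
        ∃ U : Y.Opens, y ∈ U ∧ ∀ y' : Y, y' ∈ U → idealOrder I y' = ((n : ℕ) : ℕ∞) → IsContactPt f I n y'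

/-- STEP (i): a stalk-contact element comes from a SECTION of `Diff^{≤ n-1}(𝓘)` over an affine neighbourhood whose germ
has order exactly one. [folklore] -/
theorem exists_section_of_isStalkContactPt {F : Type} [Field F] {Y : Scheme.{0}} (f : Y ⟶ Spec (.of F))
    [LocallyOfFiniteType f] (I : Y.IdealSheafData) (n : ℕ) (y : Y) (h : IsStalkContactPt f I n y) :
    ∃ (U : Y.affineOpens) (hyU : y ∈ (U : Y.Opens)) (s : Γ(Y, U)),
      s ∈ (diffIdealSheaf (f.appTop.hom.comp (Scheme.ΓSpecIso (.of F)).inv.hom) (n - 1) I).ideal U ∧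
      (Y.presheaf.germ U y hyU).hom s ∈ maximalIdeal (Y.presheaf.stalk y) ∧
      (Y.presheaf.germ U y hyU).hom s ∉ maximalIdeal (Y.presheaf.stalk y) ^ 2 := by
  obtain ⟨u, hu, hum, hum2⟩ := h
  set φ := f.appTop.hom.comp (Scheme.ΓSpecIso (.of F)).inv.hom with hφ
  have hft := hasFiniteTypeSections_of_locallyOfFiniteType F f
  set Jd := diffIdealSheaf φ (n - 1) I with hJd
  have hu' : u ∈ stalkIdeal Jd y := by
    rw [hJd, stalkIdeal_diffIdealSheaf hft (n - 1) I y]; exact hu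
  obtain ⟨U, hU, hyU, -⟩ :=
    exists_isAffineOpen_mem_and_subset (X := Y) (x := y) (U := ⊤) (Opens.mem_top y)
  rw [stalkIdeal_eq_map_germ Jd ⟨U, hU⟩ hyU] at hu'
  letI : Algebra Γ(Y, U) (Y.presheaf.stalk y) := TopCat.Presheaf.algebra_section_stalk Y.presheaf ⟨y, hyU⟩
  haveI : IsLocalization.AtPrime (Y.presheaf.stalk y) (hU.primeIdealOf ⟨y, hyU⟩).asIdeal :=
    hU.isLocalization_stalk ⟨y, hyU⟩
  have hu'' : u ∈ Ideal.map (algebraMap Γ(Y, U) (Y.presheaf.stalk y)) (Jd.ideal ⟨U, hU⟩) := hu'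
  obtain ⟨⟨⟨s, hs⟩, ⟨t, ht⟩⟩, hst⟩ :=
    (IsLocalization.mem_map_algebraMap_iff (hU.primeIdealOf ⟨y, hyU⟩).asIdeal.primeCompl (Y.presheaf.stalk y)).mp hu''
  simp only at hst
  have htu : IsUnit (algebraMap Γ(Y, U) (Y.presheaf.stalk y) t) :=
    IsLocalization.map_units (Y.presheaf.stalk y) ⟨t, ht⟩
  refine ⟨⟨U, hU⟩, hyU, s, hs, ?_, ?_⟩
  · change algebraMap Γ(Y, U) (Y.presheaf.stalk y) s ∈ _
    rw [← hst]; exact Ideal.mul_mem_right _ _ hum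
  · change algebraMap Γ(Y, U) (Y.presheaf.stalk y) s ∉ _
    rw [← hst]; intro hmem
    apply hum2
    obtain ⟨v, hv⟩ := htu
    have : u = u * algebraMap Γ(Y, U) (Y.presheaf.stalk y) t * ↑v⁻¹ := by
      rw [← hv, mul_assoc, Units.mul_inv, mul_one]
    rw [this]; exact Ideal.mul_mem_right _ _ hmem

/-- STEP (ii): a section of `Diff^{≤ n-1}(𝓘)` vanishes at every point of order `n ≥ 1`. [folklore] -/
theorem germ_mem_maximalIdeal_of_idealOrder_eq {F : Type} [Field F] {Y : Scheme.{0}} (f : Y ⟶ Spec (.of F))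
    [LocallyOfFiniteType f] (I : Y.IdealSheafData) {n : ℕ} (hn : 1 ≤ n) (U : Y.affineOpens) {s : Γ(Y, U)}
    (hs : s ∈ (diffIdealSheaf (f.appTop.hom.comp (Scheme.ΓSpecIso (.of F)).inv.hom) (n - 1) I).ideal U)
    {z : Y} (hzU : z ∈ (U : Y.Opens)) (hz : idealOrder I z = ((n : ℕ) : ℕ∞)) :
    (Y.presheaf.germ U z hzU).hom s ∈ maximalIdeal (Y.presheaf.stalk z) := by
  have hft := hasFiniteTypeSections_of_locallyOfFiniteType F f
  have hle : (((n - 1 + 1 : ℕ) : ℕ) : ℕ∞) ≤ idealOrder I z := by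
    rw [hz, Nat.sub_add_cancel hn]
  have hsupp := mem_support_diffIdealSheaf_of_le_idealOrder hft I hle
  rw [mem_support_iff_stalkIdeal_le] at hsupp
  exact hsupp (map_germ_le_stalkIdeal _ U hzU (Ideal.mem_map_of_mem _ hs))

/-- STEP (iv): the order-`≤ 1` locus of a section is OPEN on a regular scheme of finite type over a field
(upper semicontinuity of the order on an integral excellent neighbourhood — the irreducible component of `y` is open).
[folklore] -/
theorem exists_opens_forall_germ_not_mem_sq {F : Type} [Field F] {Y : Scheme.{0}} (f : Y ⟶ Spec (.of F))
    [LocallyOfFiniteType f] [QuasiCompact f] (hreg : Scheme.IsRegular Y) (U₀ : Y.affineOpens) (s : Γ(Y, U₀))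
    {y : Y} (hyU₀ : y ∈ (U₀ : Y.Opens))
    (hy : (Y.presheaf.germ U₀ y hyU₀).hom s ∉ maximalIdeal (Y.presheaf.stalk y) ^ 2) :
    ∃ V : Y.Opens, y ∈ V ∧ ∃ hVU : V ≤ (U₀ : Y.Opens), ∀ (y' : Y) (hy' : y' ∈ V),
      (Y.presheaf.germ U₀ y' (hVU hy')).hom s ∉ maximalIdeal (Y.presheaf.stalk y') ^ 2 := by
  classical
  haveI : IsLocallyNoetherian Y := LocallyOfFiniteType.isLocallyNoetherian f
  haveI : CompactSpace Y := QuasiCompact.compactSpace_of_compactSpace f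
  haveI : IsNoetherian Y := {}
  haveI : IsReduced Y := hreg.isReduced
  -- the irreducible component of `y` is open
  set C : Set Y := irreducibleComponent y with hC
  have hCmem : C ∈ irreducibleComponents Y := irreducibleComponent_mem_irreducibleComponents y
  let W : Y.Opens := Y.irreducibleComponentOpen C
  have hWC : (W : Set Y) = C := hreg.coe_irreducibleComponentOpen hCmem
  have hyW : y ∈ W := by
    rw [← SetLike.mem_coe, hWC]; exact mem_irreducibleComponent
  -- an affine open `U ∋ y` inside `U₀ ∩ W`
  obtain ⟨U, hU, hyU, hUsub⟩ :=
    exists_isAffineOpen_mem_and_subset (X := Y) (x := y) (U := (U₀ : Y.Opens) ⊓ W) ⟨hyU₀, hyW⟩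
  have hUU₀ : U ≤ (U₀ : Y.Opens) := fun z hz => (hUsub hz).1
  have hUW : (U : Set Y) ⊆ C := fun z hz => hWC ▸ (hUsub hz).2
  -- the open subscheme `U` is integral, Noetherian, regular and excellent
  have hUirr : IsIrreducible (U : Set Y) :=
    ⟨⟨y, hyU⟩, isIrreducible_irreducibleComponent.2.open_subset U.2 hUW⟩
  haveI : IrreducibleSpace (U : Scheme.{0}) := Subtype.irreducibleSpace hUirr
  haveI : IsReduced (U : Scheme.{0}) := isReduced_of_isOpenImmersion U.ι
  haveI : IsIntegral (U : Scheme.{0}) := isIntegral_of_irreducibleSpace_of_isReduced _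
  haveI : IsAffine (U : Scheme.{0}) := hU
  haveI : CompactSpace (U : Scheme.{0}) := isCompact_iff_compactSpace.mp hU.isCompact
  haveI : IsNoetherian (U : Scheme.{0}) := {}
  have hregU : Scheme.IsRegular (U : Scheme.{0}) := Scheme.IsRegular.of_isOpenImmersion U.ι hreg
  have hexcU : Scheme.IsExcellent (U : Scheme.{0}) :=
    Scheme.isExcellent_of_locallyOfFiniteType Stacks07QW_field_holds (U.ι ≫ f)
  -- the section restricted to `U`, moved to the open subscheme, and its principal ideal sheaf
  set sU : Γ(Y, U) := (Y.presheaf.map (homOfLE hUU₀).op).hom s with hsU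
  have hgermU : ∀ (z : Y) (hz : z ∈ U), (Y.presheaf.germ U z hz).hom sU = (Y.presheaf.germ U₀ z (hUU₀ hz)).hom s :=
    fun z hz => TopCat.Presheaf.germ_res_apply Y.presheaf (homOfLE hUU₀) z hz s
  set s' : Γ((U : Scheme.{0}), ⊤) := U.topIso.inv.hom sU with hs'
  set J : (U : Scheme.{0}).IdealSheafData := Scheme.IdealSheafData.ofIdealTop (Ideal.span {s'}) with hJ
  -- germs along the stalk isomorphism of the open immersion
  have hgerm' : ∀ x : (U : Scheme.{0}),
      ((U.stalkIso x).hom).hom (((U : Scheme.{0}).presheaf.germ ⊤ x (Opens.mem_top _)).hom s') =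
        (Y.presheaf.germ U x.1 x.2).hom sU := by
    intro x
    have h1 := Scheme.Opens.germ_stalkIso_hom U (V := ⊤) x (Opens.mem_top _)
    have h2 := congrArg (fun φ => φ.hom s') h1
    simp only [CommRingCat.hom_comp, RingHom.comp_apply] at h2
    rw [h2, hs', Scheme.Opens.topIso_inv]
    exact TopCat.Presheaf.germ_res_apply' Y.presheaf _ _ _ _
  have key : ∀ x : (U : Scheme.{0}), ((2 : ℕ) : ℕ∞) ≤ idealOrder J x ↔
      (Y.presheaf.germ U x.1 x.2).hom sU ∈ maximalIdeal (Y.presheaf.stalk x.1) ^ 2 := by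
    intro x
    rw [le_idealOrder_iff, stalkIdeal_eq_map_germ J ⟨⊤, isAffineOpen_top _⟩ (Opens.mem_top _)]
    change Ideal.map _ ((Scheme.IdealSheafData.ofIdealTop (Ideal.span {s'})).ideal ⟨⊤, isAffineOpen_top _⟩) ≤ _ ↔ _
    rw [ideal_ofIdealTop_top, Ideal.map_span, Set.image_singleton, Ideal.span_singleton_le_iff_mem]
    let e := (U.stalkIso x).commRingCatIsoToRingEquiv
    rw [← not_iff_not, notMem_sq_maximalIdeal_iff_of_ringEquiv e, ← hgerm' x]
    rfl
  have hJne : J ≠ ⊥ := by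
    intro hbot
    have h1 : J.ideal ⟨⊤, isAffineOpen_top _⟩ = Ideal.span {s'} := ideal_ofIdealTop_top _
    rw [hbot, Scheme.IdealSheafData.ideal_bot, Pi.bot_apply] at h1
    have hs0 : s' = 0 := by
      have : s' ∈ (⊥ : Ideal Γ((U : Scheme.{0}), ⊤)) := by rw [h1]; exact Ideal.mem_span_singleton_self _
      simpa using this
    apply hy
    rw [← hgermU y hyU, ← hgerm' ⟨y, hyU⟩, hs0, map_zero, map_zero]
    exact zero_mem _
  -- the closed set `{ord ≥ 2}` of `J` and its open complement
  have hclosed : IsClosed {x : (U : Scheme.{0}) | ((2 : ℕ) : ℕ∞) ≤ idealOrder J x} :=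
    isClosed_setOf_le_idealOrder hregU hexcU hJne _
  set O : Set (U : Scheme.{0}) := {x | ((2 : ℕ) : ℕ∞) ≤ idealOrder J x}ᶜ with hO
  have hOopen : IsOpen O := hclosed.isOpen_compl
  refine ⟨⟨Subtype.val '' O, U.2.isOpenMap_subtype_val _ hOopen⟩, ?_, ?_, ?_⟩
  · refine ⟨⟨y, hyU⟩, ?_, rfl⟩
    have h1 : ¬ ((2 : ℕ) : ℕ∞) ≤ idealOrder J ⟨y, hyU⟩ := by
      rw [key ⟨y, hyU⟩, hgermU y hyU]; exact hy
    exact h1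
  · rintro z ⟨x, -, rfl⟩; exact hUU₀ x.2
  · rintro z ⟨x, hx, rfl⟩
    have hx' : ¬ ((2 : ℕ) : ℕ∞) ≤ idealOrder J x := hx
    rw [key x, hgermU x.1 x.2] at hx'
    exact hx'

/-- Germ transport along the stalk isomorphism of an open subscheme: the germ at `x` (in `U`) of the section
`s ∈ Γ(Y, U)` moved to `Γ(U, ⊤)` is the germ of `s` at `x.1` (in `Y`). [folklore] -/
theorem germ_stalkIso_topIso_inv {Y : Scheme.{0}} (U : Y.Opens) (s : Γ(Y, U)) (x : (U : Scheme.{0})) :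
    ((U.stalkIso x).hom).hom (((U : Scheme.{0}).presheaf.germ ⊤ x (Opens.mem_top _)).hom (U.topIso.inv.hom s)) =
      (Y.presheaf.germ U x.1 x.2).hom s := by
  have h1 := Scheme.Opens.germ_stalkIso_hom U (V := ⊤) x (Opens.mem_top _)
  have h2 := congrArg (fun φ => φ.hom (U.topIso.inv.hom s)) h1
  simp only [CommRingCat.hom_comp, RingHom.comp_apply] at h2
  rw [h2, Scheme.Opens.topIso_inv]
  exact TopCat.Presheaf.germ_res_apply' Y.presheaf _ _ _ _

/-- Order one is insensitive to passing to an open subscheme. [folklore] -/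
theorem germ_topIso_inv_not_mem_sq_iff {Y : Scheme.{0}} (U : Y.Opens) (s : Γ(Y, U)) (x : (U : Scheme.{0})) :
    ((U : Scheme.{0}).presheaf.germ ⊤ x (Opens.mem_top _)).hom (U.topIso.inv.hom s) ∉
        maximalIdeal ((U : Scheme.{0}).presheaf.stalk x) ^ 2 ↔
      (Y.presheaf.germ U x.1 x.2).hom s ∉ maximalIdeal (Y.presheaf.stalk x.1) ^ 2 := by
  rw [notMem_sq_maximalIdeal_iff_of_ringEquiv (U.stalkIso x).commRingCatIsoToRingEquiv,
    ← germ_stalkIso_topIso_inv U s x]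
  rfl

/-- STEP (iv) without quasi-compactness: restrict to the affine neighbourhood carrying the section. [folklore] -/
theorem exists_opens_forall_germ_not_mem_sq' {F : Type} [Field F] {Y : Scheme.{0}} (f : Y ⟶ Spec (.of F))
    [LocallyOfFiniteType f] (hreg : Scheme.IsRegular Y) (U₀ : Y.affineOpens) (s : Γ(Y, U₀))
    {y : Y} (hyU₀ : y ∈ (U₀ : Y.Opens))
    (hy : (Y.presheaf.germ U₀ y hyU₀).hom s ∉ maximalIdeal (Y.presheaf.stalk y) ^ 2) :
    ∃ V : Y.Opens, y ∈ V ∧ ∃ hVU : V ≤ (U₀ : Y.Opens), ∀ (y' : Y) (hy' : y' ∈ V),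
      (Y.presheaf.germ U₀ y' (hVU hy')).hom s ∉ maximalIdeal (Y.presheaf.stalk y') ^ 2 := by
  -- the affine open subscheme `X = U₀` with its structure map to `Spec F`
  haveI : IsAffine ((U₀ : Y.Opens) : Scheme.{0}) := U₀.2
  have hregX : Scheme.IsRegular ((U₀ : Y.Opens) : Scheme.{0}) := Scheme.IsRegular.of_isOpenImmersion (U₀ : Y.Opens).ι hreg
  have hy' : (((U₀ : Y.Opens) : Scheme.{0}).presheaf.germ ⊤ (⟨y, hyU₀⟩ : (U₀ : Y.Opens)) (Opens.mem_top _)).hom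
      ((U₀ : Y.Opens).topIso.inv.hom s) ∉ maximalIdeal _ ^ 2 :=
    (germ_topIso_inv_not_mem_sq_iff (U₀ : Y.Opens) s ⟨y, hyU₀⟩).mpr hy
  obtain ⟨V', hyV', hV'le, hV'⟩ := exists_opens_forall_germ_not_mem_sq ((U₀ : Y.Opens).ι ≫ f) hregX
    ⟨⊤, isAffineOpen_top _⟩ ((U₀ : Y.Opens).topIso.inv.hom s) (y := ⟨y, hyU₀⟩) (Opens.mem_top _) hy'
  refine ⟨⟨Subtype.val '' (V' : Set ((U₀ : Y.Opens) : Scheme.{0})), (U₀ : Y.Opens).2.isOpenMap_subtype_val _ V'.2⟩,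
    ⟨⟨y, hyU₀⟩, hyV', rfl⟩, ?_, ?_⟩
  · rintro z ⟨x, -, rfl⟩; exact x.2
  · rintro z ⟨x, hx, rfl⟩
    exact (germ_topIso_inv_not_mem_sq_iff (U₀ : Y.Opens) s x).mp (hV' x hx)

/-- **PIECE L2 · `ContactSpreads` PROVED**: stalk contact at a top point spreads to section contact on an open
neighbourhood of top points. [folklore] -/
theorem contactSpreads_holds : ContactSpreads := by
  intro F _ Y f hlft hreg I n hn _hord y _hy hst
  haveI := hlft
  obtain ⟨U₀, hyU₀, s, hs, -, hsm2⟩ := exists_section_of_isStalkContactPt f I n y hst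
  obtain ⟨V, hyV, hVU, hV⟩ := exists_opens_forall_germ_not_mem_sq' f hreg U₀ s hyU₀ hsm2
  exact ⟨V, hyV, fun y' hy' hord' =>
    ⟨U₀, hVU hy', s, hs, germ_mem_maximalIdeal_of_idealOrder_eq f I hn U₀ hs (hVU hy') hord', hV y' hy'⟩⟩

/-- and the quasi-compact variant follows trivially. [folklore] -/
theorem contactSpreadsQC_holds : ContactSpreadsQC :=
  fun F _ Y f hlft _ hreg I n hn hord y hy hst => contactSpreads_holds F Y f hlft hreg I n hn hord y hy hst

end Summit.ResolutionOfSingularities.ResolutionOfSingularities.Theorems.SubfieldContactClasses
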